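import Summits.QuantumFields.YangMills.Theorems.BalabanUVNodesN18AdmTransportPlaqSmall
import Summits.QuantumFields.YangMills.Theorems.BalabanUVNodesN18HLayerW1Recursion

/-!
# BalabanUVNodes ∕ node N18 = NE5 — N18 FOR W1's GENERATED TOWERS OF RECORD: the END run on the admissible pairing's carriers with its levels leaves L05 ∕ L06
# PRODUCED from dag-n18-c g4's PER-GENERATOR SCHEMA (GEN) on node00-def-W1 g4's recursion object `W1.toClusterTower G` (Track A, DAG node N18 =
# `T4OutputRate.NE5` :211; cluster K4 «SpineRates», item K3′ `SpineGivenEndpointR12`; module 15 of seat pub-ymgap-dag-n18-d, strategy s2)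

HONEST FRAMING.  Count-neutral kernel bookkeeping (`--supports stmt-QuantumFields-19908 --as helper`), composition BY NAME of landed theorems; NE5 is NOT
PRINTED and NOT proved; N18 is NOT discharged; no inhabitant of `IsDatumOfRecord₁₂C` is claimed (K0′).

WHY.  node00-def-W1 g4's `Node00/HistoryRecursionOfRecord` (p481041) types the (2.14) terms of record as an OBJECT: a generator tower `G : W1.GenTower P 𝔸 M` (per
step: indices, the generic term as a function of the LAST coupling and of the OLDER TERMS) and the generated tower `W1.toClusterTower G` whose (2.13) terms are the
well-founded recursion `recTerm` ([I] (2.12)–(2.13) p.268, [II] (1.41), (2.14)).  dag-n18-c g4's `…N18HLayerW1Recursion` (p486412) proves [I] Theorem 1's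
inductive assumptions for such towers from a PER-GENERATOR schema (GEN) — for every step `m`, last coupling `t ∈ D` and older-term table obeying (1.18)(E, r₁) +
analyticity on the tables, the step-`m` activity `(G m).H t old · Z` is analytic on `sp (m+1) Z` and (2.38)-bounded (amplitude `A`, rate `R`) — and delivers the
END's levels leaves at the admissible pairing for generated towers (`decayBound_EA∕EB_ofRecordAdm_toClusterTower_of_stepGen`, amplitude renewed to `E`).  This file
plugs them into the END (module 9) at the admissible reading whose towers ARE generated, `S F θ k := toClusterTower (G F θ k)` — the trigger (t4) of this seat's
HANDOFF («W1's towers-of-record object lands ⇒ instantiate at it») in the only form the tree can state today.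

WHAT.
* §1 `n18At_pairingAdm_toClusterTower_of_stepGen` — `N18At` at the admissible pairing for the generated towers `toClusterTower G ∕ G′` from the END's data over its
  carriers + (GEN) for both generators on `sp k` ∕ `sp (k+1)` (+ restriction-closedness, the located rate clause, STRICT [KP86] clauses, renewals, `]0, γ] ⊆ D`).
* §2 `s_N18_readingAdm₁₂_toClusterTower_of_stepGen` — THE ROW AT THE ADMISSIBLE READING FOR GENERATED TOWERS ⇒ `S_N18 (RRec₁₂ 𝔯_adm)`.
* §3 `s_N18_readingAdmPlaqSmall₁₂_toClusterTower_of_stepGen` — the same ON THE PLAQUETTE-SMALL TABLES with the transport of record (restriction clauses trivial,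
  transport clause any proof — module 13 §4).
What REMAINS displayed: the END's data-direction datum and leaves (NODE O ∕ rows NE2–NE3); (GEN) for the GENERATORS OF RECORD ([II] Lemmas 1–3 ∕ NODE A for the
actual (2.14) integrands — W1's `StepGen.T` is abstract); the generators `G` themselves; the table family ∕ thresholds; K0′.  One finite four-torus programme at fixed
`ε`; NOT the continuum limit, NOT OS, NOT a mass gap, NOT Clay.  0 `def`, 0 `sorry`.  Sources (TYPES only): T. Bałaban, CMP **109** (1987) [Balaban1987RG1] (0.18)
p. 255, (0.24)–(0.25) p. 257, Thm 1 p. 259, (1.18) p. 263, (2.12)–(2.13) p. 268; CMP **116** (1988) [Balaban1988RG2Cluster] Lemma 2 (1.41) p. 11, (2.13)–(2.14)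
pp. 14–15, (2.16)–(2.18) p. 16, Lemma 3 (2.38) p. 20, (2.41) p. 21, p. 22; CMP **98** (1985) [Balaban1985Averaging] Prop. 1 (51) p. 26; R. Kotecký–D. Preiss, CMP
**103** (1986) [KoteckyPreiss1986] Thm 1 p. 492.
-/

noncomputable section

open Set Metric
open scoped Matrix.Norms.L2Operator

namespace YMDAG.N18.W1Reading

open Literature.MathematicalPhysics.QuantumFieldTheory.Balaban1983to89
open Literature.MathematicalPhysics.QuantumFieldTheory.Balaban1983to89.T4Continuum
open Literature.MathematicalPhysics.QuantumFieldTheory.Balaban1983to89.T4OutputRate (Carriers Functional NE5 DecayBound Window)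
open Literature.MathematicalPhysics.QuantumFieldTheory.Balaban1983to89.T4InputCauchyRateData (StepModel)
open Literature.MathematicalPhysics.QuantumFieldTheory.Balaban1983to89.B13Resummation (locE)
open Literature.MathematicalPhysics.QuantumFieldTheory.Balaban1983to89.TreeLengthTorus (TDom tsys torusTreeLen)
open Literature.MathematicalPhysics.QuantumFieldTheory.Balaban1983to89.TreeLengthTorusGeometry (TTouch)
open Literature.MathematicalPhysics.QuantumFieldTheory.Balaban1983to89.B12TreeDecay (K₀)
open Literature.MathematicalPhysics.QuantumFieldTheory.Balaban1983to89.Node00 (Stage12Params IsDatumOfRecord₁₂C U3Letters₁₁ U3Objects₁₁ NE2Objects₁₁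
  NE3Letters₁₁ RateAssignment₁₂ prependCoupling MatA ιSU avOfRecord)
open Literature.MathematicalPhysics.QuantumFieldTheory.Balaban1983to89.Node00.Sect2 (domCount domSys CPair ofBackgroundC)
open Literature.MathematicalPhysics.QuantumFieldTheory.Balaban1983to89.Node00.W1 (ReadingData LevelPairing LetterInputs ClusterTower pairOfRecord
  dj_pairOfRecord functionalC functional termC box SpRestr AdmBg GenTower OlderTerms toClusterTower)
open Summit.QuantumFields.BalabanUV.T4Continuum.B13Carriers (transportRaw)
open Summit.QuantumFields.BalabanUV.T4Continuum.Spine.NE5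
open Summit.QuantumFields.YangMills.BalabanUVNodes.N18AtByName (n18At_mono)
open Summit.QuantumFields.YangMills.BalabanUVNodes.N18HLayerW1Recursion (decayBound_EA_ofRecordAdm_toClusterTower_of_stepGen
  decayBound_EB_ofRecordAdm_toClusterTower_of_stepGen)
open YMDAG.N18.HLayer
open YMDAG.UVSplit

variable {N : ℕ} [NeZero N]

/-! ## §1 At the admissible pairing of record, generated towers: the END with L05 ∕ L06 from (GEN) -/

section Pairing

variable {F : T4Family} {M k : ℕ}
  (sp : (k j : ℕ) → (domSys (F.P k) M j).Dom → Set (CPair (F.P k) (MatA N)))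
  (gauge : GaugeField (F.P k) 0 (Node00.SU N) → GaugeField (F.P k) 0 (Node00.SU N) → ℝ) (hg : ∀ U U', 0 ≤ gauge U U')
  (transport : GaugeField (F.P (k + 1)) 0 (Node00.SU N) → GaugeField (F.P k) 0 (Node00.SU N))
  (hT : ∀ U : GaugeField (F.P (k + 1)) 0 (Node00.SU N),
    (∀ (j : ℕ) (Y : (domSys (F.P (k + 1)) M j).Dom), ofBackgroundC (ιSU N) U ∈ sp (k + 1) j Y) →
      ∀ (j : ℕ) (Y : (domSys (F.P k) M j).Dom), ofBackgroundC (ιSU N) (transport U) ∈ sp k j Y)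
  (G : GenTower (F.P k) (MatA N) M) (G' : GenTower (F.P (k + 1)) (MatA N) M) (D : Set ℂ)
variable {Op Hist : Type*} [NormedAddCommGroup Op] [NormedSpace ℂ Op] [NormedAddCommGroup Hist] [NormedSpace ℂ Hist]

omit [NeZero N] in
open Classical in
/-- **N18 AT THE ADMISSIBLE PAIRING OF RECORD FOR GENERATED TOWERS, LEVELS LEAVES FROM (GEN)** [bookkeeping; module 9 §2 `n18At_pairing_of_envelopeOnW1Carriers`
at `R := LevelPairing.ofRecordAdm F M N k sp gauge hg T₀ hT`, towers `toClusterTower G ∕ G′`, with `l05 ∕ l06 :=` dag-n18-c g4's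
`decayBound_EA∕EB_ofRecordAdm_toClusterTower_of_stepGen`].  Hypotheses: (i) the END's data over the pairing's carriers (per-member step models representing (2.13)
with THE NODE-A MAJORANT AS HYPOTHESIS, L01–L03 on the generated towers' functionals, L07–L09*, the located numerals with the levels letters `E_A ∕ E_B`, L10,
the sharp clause); (ii) FOR EACH RUN, dag-n18-c's PER-GENERATOR SCHEMA (GEN) for its generator on its tables — for every step `m`, last coupling `t ∈ D` and
older-term table obeying (1.18)(E, κ) + analyticity on the tables, the step-`m` activity is analytic on the next table and (2.38)-bounded with amplitude
`A_A ∕ A_B` and the END's rate `R_d` —, the tables restriction-closed, the STRICT [KP86] clauses, the renewals `e·576·K₀(64,8)²·A ≤ E`, and `]0, γ] ⊆ D`.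
NO embedding clause, NO pairing clause, NO tower-level hypothesis. [cite: Balaban1987RG1, Thm 1 p.259, (1.18) p.263 and (2.12)–(2.13) p.268; Balaban1988RG2Cluster, (1.41) p.11, (2.13)–(2.14) pp.14–15, (2.16)–(2.18) p.16, Lemma 3 (2.38) p.20 and p.22; KoteckyPreiss1986, Thm 1 p.492] -/
theorem n18At_pairingAdm_toClusterTower_of_stepGen
    (Mb : ℝ → StepModel (LevelPairing.ofRecordAdm F M N k sp gauge hg transport hT).carriers Op Hist)
    {act : ℝ → (j : ℕ) → Op × Hist → TDom 4 (domCount (F.P k) M j) → ℂ} {γ C3 ε₁ Rd κ A_A A_B E_A E_B E₁ δ δ' θ θ' cH ω ρ₀ B : ℝ} {k₀ : ℕ}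
    -- (i) the END's data on the pairing's carriers
    (hrep : ∀ b : ℝ, 0 < b → b ≤ γ → ∀ (X : Node00.W1.Dom (F.P k) M) (z : Op × Hist),
      (Mb b).Out X.1 z.1 z.2 X =
        locE (TTouch (d := 4) (N := domCount (F.P k) M X.1)) (fun Z : (tsys 4 (domCount (F.P k) M X.1)).Dom => Z.1) (act b X.1 z) X.2.1)
    (hC3 : 0 ≤ C3) (hε₁ : 0 ≤ ε₁) (hκ : 0 ≤ κ) (hrate : κ + 2 * (64 * Real.log 162) + 2 ≤ Rd)
    (hKP : C3 * ε₁ * Real.exp (5 * κ + 1) * K₀ 64 8 * 9 * 64 ≤ 1)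
    (hH : ∀ b : ℝ, 0 < b → b ≤ γ → ∀ j, ∀ g ∈ Window γ, ∀ (U : (LevelPairing.ofRecordAdm F M N k sp gauge hg transport hT).BgB) (q : Op × Hist),
      q ∈ (Mb b).Base j g U →
      ∃ V : Set (Op × Hist), IsOpen V ∧ (Mb b).box j q ⊆ V ∧
        (∀ Z : TDom 4 (domCount (F.P k) M j), DifferentiableOn ℂ (fun z : Op × Hist => act b j z Z) V) ∧
        (∀ z ∈ V, ∀ Z : TDom 4 (domCount (F.P k) M j), ‖act b j z Z‖ ≤ C3 * ε₁ * Real.exp (-(Rd * torusTreeLen Z.1))))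
    (l01 : ∀ b : ℝ, 0 < b → b ≤ γ → L01 (Mb b) ((LevelPairing.ofRecordAdm F M N k sp gauge hg transport hT).EA (toClusterTower G)) (Window γ))
    (l02 : ∀ b : ℝ, 0 < b → b ≤ γ → L02 (Mb b) ((LevelPairing.ofRecordAdm F M N k sp gauge hg transport hT).EB (toClusterTower G') b) (Window γ))
    (l03 : ∀ b : ℝ, 0 < b → b ≤ γ → L03 (Mb b) ((LevelPairing.ofRecordAdm F M N k sp gauge hg transport hT).EB (toClusterTower G') b) (Window γ))
    (l07 : ∀ b : ℝ, 0 < b → b ≤ γ → L07 (Mb b) (Window γ) δ θ)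
    (l08 : ∀ b : ℝ, 0 < b → b ≤ γ → L08 (Mb b) (Window γ) κ E_B δ' θ)
    (l09aff : ∀ b : ℝ, 0 < b → b ≤ γ → L09aff (Mb b) (Window γ)) (l09blind : ∀ b : ℝ, 0 < b → b ≤ γ → L09blind (Mb b) (Window γ))
    (l09hom : ∀ b : ℝ, 0 < b → b ≤ γ → L09hom (Mb b) (Window γ))
    (l09unit : ∀ b : ℝ, 0 < b → b ≤ γ → L09unit (Mb b) (Window γ) κ E₁ cH ω)
    (hE₁ : 0 < E₁) (hδ : 0 ≤ δ + δ') (hθ : 0 ≤ θ) (hθθ' : θ ≤ θ') (hθ'1 : θ' ≤ 1) (hcH : 0 ≤ cH) (hω : 0 < ω) (hρ₀ : ρ₀ < 1)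
    (l10near : (δ + δ') * θ ^ k₀ + cH * (E_A + E_B) / (1 - ω) ≤ ρ₀) (hB : 0 ≤ B) (l10first : ∀ k < k₀, E_A + E_B ≤ B * θ ^ k)
    (hS : Real.exp 1 * 9 * 64 * K₀ 64 8 ^ 2 * C3 * cH * ε₁ < (θ' - ω) * (1 - ρ₀))
    -- (ii) dag-n18-c's PER-GENERATOR SCHEMA (GEN) for run A's generator on the tables `sp k`
    (hrestrA : ∀ m, SpRestr (sp k (m + 1)))
    (hgenA : ∀ m : ℕ, ∀ t ∈ D, ∀ old : OlderTerms (F.P k) (MatA N) M m,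
      (∀ (j : Fin (m + 1)) (Y : (domSys (F.P k) M j).Dom), ∀ ψ ∈ sp k j Y, ‖old j Y ψ‖ ≤ E_A * Real.exp (-(κ * (domSys (F.P k) M j).dj Y))) →
      (∀ (j : Fin (m + 1)) (Y : (domSys (F.P k) M j).Dom), AnalyticOnNhd ℂ (old j Y) (sp k j Y)) →
      (∀ Z : (domSys (F.P k) M (m + 1)).Dom, AnalyticOnNhd ℂ (fun φ => (G m).H t old φ Z) (sp k (m + 1) Z)) ∧
      (∀ (Z : (domSys (F.P k) M (m + 1)).Dom), ∀ φ ∈ sp k (m + 1) Z, ‖(G m).H t old φ Z‖ ≤ A_A * Real.exp (-(Rd * (domSys (F.P k) M (m + 1)).dj Z))))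
    (hAA : 0 ≤ A_A) (hsmallA : A_A * Real.exp (5 * κ + 1) * K₀ 64 8 * 9 * 64 < 1) (hrenewA : Real.exp 1 * 9 * 64 * K₀ 64 8 ^ 2 * A_A ≤ E_A)
    -- … and for run B's generator on the tables `sp (k+1)`
    (hrestrB : ∀ m, SpRestr (sp (k + 1) (m + 1)))
    (hgenB : ∀ m : ℕ, ∀ t ∈ D, ∀ old : OlderTerms (F.P (k + 1)) (MatA N) M m,
      (∀ (j : Fin (m + 1)) (Y : (domSys (F.P (k + 1)) M j).Dom), ∀ ψ ∈ sp (k + 1) j Y,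
          ‖old j Y ψ‖ ≤ E_B * Real.exp (-(κ * (domSys (F.P (k + 1)) M j).dj Y))) →
      (∀ (j : Fin (m + 1)) (Y : (domSys (F.P (k + 1)) M j).Dom), AnalyticOnNhd ℂ (old j Y) (sp (k + 1) j Y)) →
      (∀ Z : (domSys (F.P (k + 1)) M (m + 1)).Dom, AnalyticOnNhd ℂ (fun φ => (G' m).H t old φ Z) (sp (k + 1) (m + 1) Z)) ∧
      (∀ (Z : (domSys (F.P (k + 1)) M (m + 1)).Dom), ∀ φ ∈ sp (k + 1) (m + 1) Z,
          ‖(G' m).H t old φ Z‖ ≤ A_B * Real.exp (-(Rd * (domSys (F.P (k + 1)) M (m + 1)).dj Z))))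
    (hAB : 0 ≤ A_B) (hsmallB : A_B * Real.exp (5 * κ + 1) * K₀ 64 8 * 9 * 64 < 1) (hrenewB : Real.exp 1 * 9 * 64 * K₀ 64 8 ^ 2 * A_B ≤ E_B)
    (hD : ∀ s ∈ Ioc (0 : ℝ) γ, ((s : ℝ) : ℂ) ∈ D)
    (Λ : ℕ → ℕ → ℝ) (C₉ ωm cr ρ : ℝ) :
    N18At ⟨(LevelPairing.ofRecordAdm F M N k sp gauge hg transport hT).carriers, Window γ, γ, κ,
      (LevelPairing.ofRecordAdm F M N k sp gauge hg transport hT).EA (toClusterTower G), (LevelPairing.ofRecordAdm F M N k sp gauge hg transport hT).EB (toClusterTower G'), θ',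
      (Real.exp 1 * 9 * 64 * K₀ 64 8 ^ 2 * (C3 * ε₁) / (1 - ρ₀) * (δ + δ') + B) * (θ' - ω) /
        (θ' - (ω + Real.exp 1 * 9 * 64 * K₀ 64 8 ^ 2 * (C3 * ε₁) / (1 - ρ₀) * cH)), Λ, C₉, ωm, cr, ρ⟩ :=
  have l05 : L05 ((LevelPairing.ofRecordAdm F M N k sp gauge hg transport hT).EA (toClusterTower G)) (Window γ) E_A κ :=
    decayBound_EA_ofRecordAdm_toClusterTower_of_stepGen F M N k sp gauge hg transport hT G D hrestrA hgenA hAA hκ hrate hsmallA hrenewA hD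
  have l06 : ∀ b : ℝ, 0 < b → b ≤ γ →
      L06 ((LevelPairing.ofRecordAdm F M N k sp gauge hg transport hT).EB (toClusterTower G') b) (Window γ) E_B κ :=
    fun _ hb hbγ =>
      decayBound_EB_ofRecordAdm_toClusterTower_of_stepGen F M N k sp gauge hg transport hT G' D hrestrB hgenB hAB hκ hrate hsmallB hrenewB hD ⟨hb, hbγ⟩
  n18At_pairing_of_envelopeOnW1Carriers (LevelPairing.ofRecordAdm F M N k sp gauge hg transport hT) Mb hrep hC3 hε₁ hκ hrate hKP hH l01 l02 l03 l05 l06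
    l07 l08 l09aff l09blind l09hom l09unit hE₁ hδ hθ hθθ' hθ'1 hcH hω hρ₀ l10near hB l10first hS Λ C₉ ωm cr ρ

end Pairing

/-! ## §2 The row AT THE ADMISSIBLE READING for generated towers -/

section Record

variable (G : (F : T4Family) → (θ : Stage12Params F N) → (k : ℕ) → GenTower (F.P k) (MatA N) θ.τ9.M)
  (D : (F : T4Family) → Stage12Params F N → ℕ → Set ℂ)
  (sp : (F : T4Family) → (θ : Stage12Params F N) → (k j : ℕ) → (domSys (F.P k) θ.τ9.M j).Dom → Set (CPair (F.P k) (MatA N)))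
  (gauge : (F : T4Family) → (θ : Stage12Params F N) → (k : ℕ) → GaugeField (F.P k) 0 (Node00.SU N) → GaugeField (F.P k) 0 (Node00.SU N) → ℝ)
  (hg : ∀ (F : T4Family) (θ : Stage12Params F N) (k : ℕ) (U U' : GaugeField (F.P k) 0 (Node00.SU N)), 0 ≤ gauge F θ k U U')
  (T₀ : (F : T4Family) → (θ : Stage12Params F N) → (k : ℕ) → GaugeField (F.P (k + 1)) 0 (Node00.SU N) → GaugeField (F.P k) 0 (Node00.SU N))
  (hT : ∀ (F : T4Family) (θ : Stage12Params F N) (k : ℕ) (U : GaugeField (F.P (k + 1)) 0 (Node00.SU N)),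
    (∀ (j : ℕ) (Y : (domSys (F.P (k + 1)) θ.τ9.M j).Dom), ofBackgroundC (ιSU N) U ∈ sp F θ (k + 1) j Y) →
      ∀ (j : ℕ) (X : (domSys (F.P k) θ.τ9.M j).Dom), ofBackgroundC (ιSU N) (T₀ F θ k U) ∈ sp F θ k j X)
  (li : (F : T4Family) → Stage12Params F N → LetterInputs) (ℓ₃ : T4Family → NE3Letters₁₁)
  (ne2 : (F : T4Family) → Stage12Params F N → (ℕ → ℝ) → List (ULoop F) → ℕ → NE2Objects₁₁)
  (ne1 : (F : T4Family) → Stage12Params F N → (ℕ → ℝ) → List (ULoop F) → NE1pCarriers)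

open Classical in
/-- **THE ROW AT THE ADMISSIBLE READING FOR GENERATED TOWERS, LEVELS LEAVES FROM (GEN)** [bookkeeping; §1 once per key and level, then `N18AtByName.n18At_mono`
with module 9's `endConstant_nonneg` and module 8's bundle equation].  At the admissible reading whose towers are GENERATED, `S F θ k := toClusterTower (G F θ k)`: if
at EVERY admissible Stage-12 tuple with provisos and every run length there are (i) the END's data over the carriers of the admissible pairing and (ii) (GEN) for
both runs' generators `G F θ k ∕ (k+1)` on the tables `sp F θ k ∕ (k+1)` (restriction-closed) with coupling domain `D F θ k ⊇ ]0, γ′]`, the STRICT clauses and the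
renewals, the letters `li F θ` dominating — then `S_N18 (RRec₁₂ 𝔯_adm)`. [cite: Balaban1987RG1, (0.24)–(0.25) p.257, Thm 1 p.259, (1.18) p.263 and (2.12)–(2.13) p.268; Balaban1988RG2Cluster, (1.41) p.11, (2.13)–(2.14) pp.14–15, Lemma 3 (2.38) p.20 and p.22] -/
theorem s_N18_readingAdm₁₂_toClusterTower_of_stepGen
    (h : ∀ (F : T4Family) (θ : Stage12Params F N), θ.Provisos₁₂ F N → θ.Admissible F N → ∀ k : ℕ,
      ∃ (Op : Type) (_ : NormedAddCommGroup Op) (_ : NormedSpace ℂ Op) (Hist : Type) (_ : NormedAddCommGroup Hist) (_ : NormedSpace ℂ Hist)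
        (Mb : ℝ → StepModel (LevelPairing.ofRecordAdm F θ.τ9.M N k (sp F θ) (gauge F θ k) (hg F θ k) (T₀ F θ k) (hT F θ k)).carriers Op Hist)
        (act : ℝ → (j : ℕ) → Op × Hist → TDom 4 (domCount (F.P k) θ.τ9.M j) → ℂ) (γ' C3 ε₁ Rd κ A_A A_B E_A E_B E₁ δ δ' θr θ' cH ω ρ₀ B : ℝ)
        (k₀ : ℕ),
        -- (i) the END's data over the carriers of the admissible level pairing
        (∀ b : ℝ, 0 < b → b ≤ γ' → ∀ (X : Node00.W1.Dom (F.P k) θ.τ9.M) (z : Op × Hist),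
          (Mb b).Out X.1 z.1 z.2 X =
            locE (TTouch (d := 4) (N := domCount (F.P k) θ.τ9.M X.1)) (fun Z : (tsys 4 (domCount (F.P k) θ.τ9.M X.1)).Dom => Z.1)
              (act b X.1 z) X.2.1) ∧
        0 ≤ C3 ∧ 0 ≤ ε₁ ∧ 0 ≤ κ ∧ κ + 2 * (64 * Real.log 162) + 2 ≤ Rd ∧
        C3 * ε₁ * Real.exp (5 * κ + 1) * K₀ 64 8 * 9 * 64 ≤ 1 ∧
        (∀ b : ℝ, 0 < b → b ≤ γ' → ∀ j, ∀ g ∈ Window γ',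
          ∀ (U : (LevelPairing.ofRecordAdm F θ.τ9.M N k (sp F θ) (gauge F θ k) (hg F θ k) (T₀ F θ k) (hT F θ k)).BgB) (q : Op × Hist),
          q ∈ (Mb b).Base j g U →
          ∃ V : Set (Op × Hist), IsOpen V ∧ (Mb b).box j q ⊆ V ∧
            (∀ Z : TDom 4 (domCount (F.P k) θ.τ9.M j), DifferentiableOn ℂ (fun z : Op × Hist => act b j z Z) V) ∧
            (∀ z ∈ V, ∀ Z : TDom 4 (domCount (F.P k) θ.τ9.M j), ‖act b j z Z‖ ≤ C3 * ε₁ * Real.exp (-(Rd * torusTreeLen Z.1)))) ∧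
        (∀ b : ℝ, 0 < b → b ≤ γ' → L01 (Mb b)
          ((LevelPairing.ofRecordAdm F θ.τ9.M N k (sp F θ) (gauge F θ k) (hg F θ k) (T₀ F θ k) (hT F θ k)).EA (toClusterTower (G F θ k))) (Window γ')) ∧
        (∀ b : ℝ, 0 < b → b ≤ γ' → L02 (Mb b)
          ((LevelPairing.ofRecordAdm F θ.τ9.M N k (sp F θ) (gauge F θ k) (hg F θ k) (T₀ F θ k) (hT F θ k)).EB (toClusterTower (G F θ (k + 1))) b)
          (Window γ')) ∧
        (∀ b : ℝ, 0 < b → b ≤ γ' → L03 (Mb b)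
          ((LevelPairing.ofRecordAdm F θ.τ9.M N k (sp F θ) (gauge F θ k) (hg F θ k) (T₀ F θ k) (hT F θ k)).EB (toClusterTower (G F θ (k + 1))) b)
          (Window γ')) ∧
        (∀ b : ℝ, 0 < b → b ≤ γ' → L07 (Mb b) (Window γ') δ θr) ∧
        (∀ b : ℝ, 0 < b → b ≤ γ' → L08 (Mb b) (Window γ') κ E_B δ' θr) ∧
        (∀ b : ℝ, 0 < b → b ≤ γ' → L09aff (Mb b) (Window γ')) ∧ (∀ b : ℝ, 0 < b → b ≤ γ' → L09blind (Mb b) (Window γ')) ∧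
        (∀ b : ℝ, 0 < b → b ≤ γ' → L09hom (Mb b) (Window γ')) ∧ (∀ b : ℝ, 0 < b → b ≤ γ' → L09unit (Mb b) (Window γ') κ E₁ cH ω) ∧
        0 < E₁ ∧ 0 ≤ δ + δ' ∧ 0 ≤ θr ∧ θr ≤ θ' ∧ θ' ≤ 1 ∧ 0 ≤ cH ∧ 0 < ω ∧ ρ₀ < 1 ∧
        (δ + δ') * θr ^ k₀ + cH * (E_A + E_B) / (1 - ω) ≤ ρ₀ ∧ 0 ≤ B ∧ (∀ k < k₀, E_A + E_B ≤ B * θr ^ k) ∧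
        Real.exp 1 * 9 * 64 * K₀ 64 8 ^ 2 * C3 * cH * ε₁ < (θ' - ω) * (1 - ρ₀) ∧
        -- (ii) (GEN) for both runs' generators on the tables `sp F θ k` ∕ `sp F θ (k+1)`, restriction-closedness, STRICT clauses, renewals, `]0,γ′] ⊆ D`
        (∀ m, SpRestr (sp F θ k (m + 1))) ∧
        (∀ m : ℕ, ∀ t ∈ D F θ k, ∀ old : OlderTerms (F.P k) (MatA N) θ.τ9.M m,
          (∀ (j : Fin (m + 1)) (Y : (domSys (F.P k) θ.τ9.M j).Dom), ∀ ψ ∈ sp F θ k j Y,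
              ‖old j Y ψ‖ ≤ E_A * Real.exp (-(κ * (domSys (F.P k) θ.τ9.M j).dj Y))) →
          (∀ (j : Fin (m + 1)) (Y : (domSys (F.P k) θ.τ9.M j).Dom), AnalyticOnNhd ℂ (old j Y) (sp F θ k j Y)) →
          (∀ Z : (domSys (F.P k) θ.τ9.M (m + 1)).Dom, AnalyticOnNhd ℂ (fun φ => (G F θ k m).H t old φ Z) (sp F θ k (m + 1) Z)) ∧
          (∀ (Z : (domSys (F.P k) θ.τ9.M (m + 1)).Dom), ∀ φ ∈ sp F θ k (m + 1) Z,
              ‖(G F θ k m).H t old φ Z‖ ≤ A_A * Real.exp (-(Rd * (domSys (F.P k) θ.τ9.M (m + 1)).dj Z)))) ∧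
        0 ≤ A_A ∧ A_A * Real.exp (5 * κ + 1) * K₀ 64 8 * 9 * 64 < 1 ∧ Real.exp 1 * 9 * 64 * K₀ 64 8 ^ 2 * A_A ≤ E_A ∧
        (∀ m, SpRestr (sp F θ (k + 1) (m + 1))) ∧
        (∀ m : ℕ, ∀ t ∈ D F θ k, ∀ old : OlderTerms (F.P (k + 1)) (MatA N) θ.τ9.M m,
          (∀ (j : Fin (m + 1)) (Y : (domSys (F.P (k + 1)) θ.τ9.M j).Dom), ∀ ψ ∈ sp F θ (k + 1) j Y,
              ‖old j Y ψ‖ ≤ E_B * Real.exp (-(κ * (domSys (F.P (k + 1)) θ.τ9.M j).dj Y))) →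
          (∀ (j : Fin (m + 1)) (Y : (domSys (F.P (k + 1)) θ.τ9.M j).Dom), AnalyticOnNhd ℂ (old j Y) (sp F θ (k + 1) j Y)) →
          (∀ Z : (domSys (F.P (k + 1)) θ.τ9.M (m + 1)).Dom, AnalyticOnNhd ℂ (fun φ => (G F θ (k + 1) m).H t old φ Z) (sp F θ (k + 1) (m + 1) Z)) ∧
          (∀ (Z : (domSys (F.P (k + 1)) θ.τ9.M (m + 1)).Dom), ∀ φ ∈ sp F θ (k + 1) (m + 1) Z,
              ‖(G F θ (k + 1) m).H t old φ Z‖ ≤ A_B * Real.exp (-(Rd * (domSys (F.P (k + 1)) θ.τ9.M (m + 1)).dj Z)))) ∧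
        0 ≤ A_B ∧ A_B * Real.exp (5 * κ + 1) * K₀ 64 8 * 9 * 64 < 1 ∧ Real.exp 1 * 9 * 64 * K₀ 64 8 ^ 2 * A_B ≤ E_B ∧
        (∀ s ∈ Ioc (0 : ℝ) γ', ((s : ℝ) : ℂ) ∈ D F θ k) ∧
        -- the reading's letters dominate the END's
        θ.γ ≤ γ' ∧ (li F θ).κ ≤ κ ∧ θ' ≤ (li F θ).θ₅ ∧
        (Real.exp 1 * 9 * 64 * K₀ 64 8 ^ 2 * (C3 * ε₁) / (1 - ρ₀) * (δ + δ') + B) * (θ' - ω) /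
            (θ' - (ω + Real.exp 1 * 9 * 64 * K₀ 64 8 ^ 2 * (C3 * ε₁) / (1 - ρ₀) * cH)) ≤ (li F θ).C₅) :
    S_N18 (RRec₁₂ (readingOfRecord₁₂ (fun F θ => ReadingData.ofRecordAdm F θ.τ9.M N (fun k => toClusterTower (G F θ k)) (sp F θ) (gauge F θ) (hg F θ) (T₀ F θ) (hT F θ) (li F θ))
      ℓ₃ ne2 ne1)) := by
  refine s_N18_rRec₁₂_of_forall_admissible _ fun F θ hP hA g₀ os k => ?_
  obtain ⟨Op, _, _, Hist, _, _, Mb, act, γ', C3, ε₁, Rd, κ, A_A, A_B, E_A, E_B, E₁, δ, δ', θr, θ', cH, ω, ρ₀, B, k₀, hrep, hC3, hε₁, hκ, hrate, hKP,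
    hH, l01, l02, l03, l07, l08, l09aff, l09blind, l09hom, l09unit, hE₁, hδ, hθ, hθθ', hθ'1, hcH, hω, hρ₀, l10near, hB, l10first, hS, hrestrA, hgenA,
    hAA, hsmallA, hrenewA, hrestrB, hgenB, hAB, hsmallB, hrenewB, hD, hγ, hℓκ, hℓθ, hℓC⟩ := h F θ hP hA k
  have hN := n18At_pairingAdm_toClusterTower_of_stepGen (sp F θ) (gauge F θ k) (hg F θ k) (T₀ F θ k) (hT F θ k) (G F θ k) (G F θ (k + 1)) (D F θ k) Mb
    hrep hC3 hε₁ hκ hrate hKP hH l01 l02 l03 l07 l08 l09aff l09blind l09hom l09unit hE₁ hδ hθ hθθ' hθ'1 hcH hω hρ₀ l10near hB l10first hS hrestrA hgenA hAA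
    hsmallA hrenewA hrestrB hgenB hAB hsmallB hrenewB hD ((li F θ).analytic θ.γ).moduli ((li F θ).analytic θ.γ).C₉ ((li F θ).analytic θ.γ).ω (li F θ).cr
    (li F θ).ρ
  have hW : Window θ.γ ⊆ Window γ' := fun g hgW i => ⟨(hgW i).1, (hgW i).2.trans hγ⟩
  exact (n18At_u3OfRecord₁₂_w1_iff_pairing (pinnedInputs₁₂ (fun F θ => ReadingData.ofRecordAdm F θ.τ9.M N (fun k => toClusterTower (G F θ k)) (sp F θ) (gauge F θ) (hg F θ) (T₀ F θ)
      (hT F θ) (li F θ)) ℓ₃ ne2) F θ g₀ os k).2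
    (n18At_mono hN hW hγ hℓκ (hθ.trans hθθ') hℓθ (endConstant_nonneg hC3 hε₁ hδ hcH hρ₀ hB hS) hℓC)

end Record

/-! ## §3 The same on the PLAQUETTE-SMALL tables with the transport of record (generated towers) -/

section PlaqSmall

variable (G : (F : T4Family) → (θ : Stage12Params F N) → (k : ℕ) → GenTower (F.P k) (MatA N) θ.τ9.M)
  (D : (F : T4Family) → Stage12Params F N → ℕ → Set ℂ)
  (a : (F : T4Family) → Stage12Params F N → ℕ → ℝ)
  (hT : ∀ (F : T4Family) (θ : Stage12Params F N) (k : ℕ) (U : GaugeField (F.P (k + 1)) 0 (Node00.SU N)),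
    (∀ (j : ℕ) (Y : (domSys (F.P (k + 1)) θ.τ9.M j).Dom),
      ofBackgroundC (ιSU N) U ∈ (fun (k j : ℕ) (_ : (domSys (F.P k) θ.τ9.M j).Dom) =>
        ofBackgroundC (ιSU N) '' {V : GaugeField (F.P k) 0 (Node00.SU N) | PlaqSmall (a F θ k) V}) (k + 1) j Y) →
      ∀ (j : ℕ) (X : (domSys (F.P k) θ.τ9.M j).Dom),
        ofBackgroundC (ιSU N) (transportRaw F k (avOfRecord F N (k + 1) 0) U) ∈
          (fun (k j : ℕ) (_ : (domSys (F.P k) θ.τ9.M j).Dom) =>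
            ofBackgroundC (ιSU N) '' {V : GaugeField (F.P k) 0 (Node00.SU N) | PlaqSmall (a F θ k) V}) k j X)
  (gauge : (F : T4Family) → (θ : Stage12Params F N) → (k : ℕ) → GaugeField (F.P k) 0 (Node00.SU N) → GaugeField (F.P k) 0 (Node00.SU N) → ℝ)
  (hg : ∀ (F : T4Family) (θ : Stage12Params F N) (k : ℕ) (U U' : GaugeField (F.P k) 0 (Node00.SU N)), 0 ≤ gauge F θ k U U')
  (li : (F : T4Family) → Stage12Params F N → LetterInputs) (ℓ₃ : T4Family → NE3Letters₁₁)
  (ne2 : (F : T4Family) → Stage12Params F N → (ℕ → ℝ) → List (ULoop F) → ℕ → NE2Objects₁₁)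
  (ne1 : (F : T4Family) → Stage12Params F N → (ℕ → ℝ) → List (ULoop F) → NE1pCarriers)

open Classical in
/-- **THE ROW AT THE ε-SMALL FIELDS FOR GENERATED TOWERS** [bookkeeping; §2 at the plaquette-small tables of module 13 with the transport of record: the
restriction clauses `SpRestr` are TRIVIAL (constant tables) and the transport clause `hT` is ANY proof — module 13 §4's `admTransport_plaqSmall` ∕ `_sharp`].
END data over the admissible carriers + (GEN) for both runs' generators ON THE PLAQUETTE-SMALL TABLES + STRICT clauses + renewals + `]0, γ′] ⊆ D`, letters
dominating ⟹ `S_N18` at the admissible reading on the plaquette-small tables for the generated towers.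
[cite: Balaban1987RG1, (0.18) p.255, (0.24)–(0.25) p.257, Thm 1 p.259, (1.18) p.263 and (2.12)–(2.13) p.268; Balaban1988RG2Cluster, (1.41) p.11, (2.13)–(2.14) pp.14–15, Lemma 3 (2.38) p.20 and p.22; Balaban1985Averaging, Prop. 1 (51) p.26] -/
theorem s_N18_readingAdmPlaqSmall₁₂_toClusterTower_of_stepGen
    (h : ∀ (F : T4Family) (θ : Stage12Params F N), θ.Provisos₁₂ F N → θ.Admissible F N → ∀ k : ℕ,
      ∃ (Op : Type) (_ : NormedAddCommGroup Op) (_ : NormedSpace ℂ Op) (Hist : Type) (_ : NormedAddCommGroup Hist) (_ : NormedSpace ℂ Hist)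
        (Mb : ℝ → StepModel (LevelPairing.ofRecordAdm F θ.τ9.M N k (fun (k j : ℕ) (_ : (domSys (F.P k) θ.τ9.M j).Dom) =>
            ofBackgroundC (ιSU N) '' {V : GaugeField (F.P k) 0 (Node00.SU N) | PlaqSmall (a F θ k) V})
          (gauge F θ k) (hg F θ k) (transportRaw F k (avOfRecord F N (k + 1) 0)) (hT F θ k)).carriers Op Hist)
        (act : ℝ → (j : ℕ) → Op × Hist → TDom 4 (domCount (F.P k) θ.τ9.M j) → ℂ) (γ' C3 ε₁ Rd κ A_A A_B E_A E_B E₁ δ δ' θr θ' cH ω ρ₀ B : ℝ)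
        (k₀ : ℕ),
        -- (i) the END's data over the carriers of the admissible level pairing
        (∀ b : ℝ, 0 < b → b ≤ γ' → ∀ (X : Node00.W1.Dom (F.P k) θ.τ9.M) (z : Op × Hist),
          (Mb b).Out X.1 z.1 z.2 X =
            locE (TTouch (d := 4) (N := domCount (F.P k) θ.τ9.M X.1)) (fun Z : (tsys 4 (domCount (F.P k) θ.τ9.M X.1)).Dom => Z.1)
              (act b X.1 z) X.2.1) ∧
        0 ≤ C3 ∧ 0 ≤ ε₁ ∧ 0 ≤ κ ∧ κ + 2 * (64 * Real.log 162) + 2 ≤ Rd ∧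
        C3 * ε₁ * Real.exp (5 * κ + 1) * K₀ 64 8 * 9 * 64 ≤ 1 ∧
        (∀ b : ℝ, 0 < b → b ≤ γ' → ∀ j, ∀ g ∈ Window γ',
          ∀ (U : (LevelPairing.ofRecordAdm F θ.τ9.M N k (fun (k j : ℕ) (_ : (domSys (F.P k) θ.τ9.M j).Dom) =>
            ofBackgroundC (ιSU N) '' {V : GaugeField (F.P k) 0 (Node00.SU N) | PlaqSmall (a F θ k) V})
          (gauge F θ k) (hg F θ k) (transportRaw F k (avOfRecord F N (k + 1) 0)) (hT F θ k)).BgB) (q : Op × Hist),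
          q ∈ (Mb b).Base j g U →
          ∃ V : Set (Op × Hist), IsOpen V ∧ (Mb b).box j q ⊆ V ∧
            (∀ Z : TDom 4 (domCount (F.P k) θ.τ9.M j), DifferentiableOn ℂ (fun z : Op × Hist => act b j z Z) V) ∧
            (∀ z ∈ V, ∀ Z : TDom 4 (domCount (F.P k) θ.τ9.M j), ‖act b j z Z‖ ≤ C3 * ε₁ * Real.exp (-(Rd * torusTreeLen Z.1)))) ∧
        (∀ b : ℝ, 0 < b → b ≤ γ' → L01 (Mb b)
          ((LevelPairing.ofRecordAdm F θ.τ9.M N k (fun (k j : ℕ) (_ : (domSys (F.P k) θ.τ9.M j).Dom) =>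
            ofBackgroundC (ιSU N) '' {V : GaugeField (F.P k) 0 (Node00.SU N) | PlaqSmall (a F θ k) V})
          (gauge F θ k) (hg F θ k) (transportRaw F k (avOfRecord F N (k + 1) 0)) (hT F θ k)).EA (toClusterTower (G F θ k))) (Window γ')) ∧
        (∀ b : ℝ, 0 < b → b ≤ γ' → L02 (Mb b)
          ((LevelPairing.ofRecordAdm F θ.τ9.M N k (fun (k j : ℕ) (_ : (domSys (F.P k) θ.τ9.M j).Dom) =>
            ofBackgroundC (ιSU N) '' {V : GaugeField (F.P k) 0 (Node00.SU N) | PlaqSmall (a F θ k) V})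
          (gauge F θ k) (hg F θ k) (transportRaw F k (avOfRecord F N (k + 1) 0)) (hT F θ k)).EB (toClusterTower (G F θ (k + 1))) b)
          (Window γ')) ∧
        (∀ b : ℝ, 0 < b → b ≤ γ' → L03 (Mb b)
          ((LevelPairing.ofRecordAdm F θ.τ9.M N k (fun (k j : ℕ) (_ : (domSys (F.P k) θ.τ9.M j).Dom) =>
            ofBackgroundC (ιSU N) '' {V : GaugeField (F.P k) 0 (Node00.SU N) | PlaqSmall (a F θ k) V})
          (gauge F θ k) (hg F θ k) (transportRaw F k (avOfRecord F N (k + 1) 0)) (hT F θ k)).EB (toClusterTower (G F θ (k + 1))) b)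
          (Window γ')) ∧
        (∀ b : ℝ, 0 < b → b ≤ γ' → L07 (Mb b) (Window γ') δ θr) ∧
        (∀ b : ℝ, 0 < b → b ≤ γ' → L08 (Mb b) (Window γ') κ E_B δ' θr) ∧
        (∀ b : ℝ, 0 < b → b ≤ γ' → L09aff (Mb b) (Window γ')) ∧ (∀ b : ℝ, 0 < b → b ≤ γ' → L09blind (Mb b) (Window γ')) ∧
        (∀ b : ℝ, 0 < b → b ≤ γ' → L09hom (Mb b) (Window γ')) ∧ (∀ b : ℝ, 0 < b → b ≤ γ' → L09unit (Mb b) (Window γ') κ E₁ cH ω) ∧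
        0 < E₁ ∧ 0 ≤ δ + δ' ∧ 0 ≤ θr ∧ θr ≤ θ' ∧ θ' ≤ 1 ∧ 0 ≤ cH ∧ 0 < ω ∧ ρ₀ < 1 ∧
        (δ + δ') * θr ^ k₀ + cH * (E_A + E_B) / (1 - ω) ≤ ρ₀ ∧ 0 ≤ B ∧ (∀ k < k₀, E_A + E_B ≤ B * θr ^ k) ∧
        Real.exp 1 * 9 * 64 * K₀ 64 8 ^ 2 * C3 * cH * ε₁ < (θ' - ω) * (1 - ρ₀) ∧
        -- (ii) (GEN) for both runs' generators ON THE PLAQUETTE-SMALL TABLES (constant in `(j, Y)`), STRICT clauses, renewals, `]0,γ′] ⊆ D`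
        (∀ m : ℕ, ∀ t ∈ D F θ k, ∀ old : OlderTerms (F.P k) (MatA N) θ.τ9.M m,
          (∀ (j : Fin (m + 1)) (Y : (domSys (F.P k) θ.τ9.M j).Dom), ∀ ψ ∈ (ofBackgroundC (ιSU N) '' {V : GaugeField (F.P k) 0 (Node00.SU N) | PlaqSmall (a F θ k) V}),
              ‖old j Y ψ‖ ≤ E_A * Real.exp (-(κ * (domSys (F.P k) θ.τ9.M j).dj Y))) →
          (∀ (j : Fin (m + 1)) (Y : (domSys (F.P k) θ.τ9.M j).Dom), AnalyticOnNhd ℂ (old j Y) (ofBackgroundC (ιSU N) '' {V : GaugeField (F.P k) 0 (Node00.SU N) | PlaqSmall (a F θ k) V})) →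
          (∀ Z : (domSys (F.P k) θ.τ9.M (m + 1)).Dom, AnalyticOnNhd ℂ (fun φ => (G F θ k m).H t old φ Z) (ofBackgroundC (ιSU N) '' {V : GaugeField (F.P k) 0 (Node00.SU N) | PlaqSmall (a F θ k) V})) ∧
          (∀ (Z : (domSys (F.P k) θ.τ9.M (m + 1)).Dom), ∀ φ ∈ (ofBackgroundC (ιSU N) '' {V : GaugeField (F.P k) 0 (Node00.SU N) | PlaqSmall (a F θ k) V}),
              ‖(G F θ k m).H t old φ Z‖ ≤ A_A * Real.exp (-(Rd * (domSys (F.P k) θ.τ9.M (m + 1)).dj Z)))) ∧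
        0 ≤ A_A ∧ A_A * Real.exp (5 * κ + 1) * K₀ 64 8 * 9 * 64 < 1 ∧ Real.exp 1 * 9 * 64 * K₀ 64 8 ^ 2 * A_A ≤ E_A ∧
        (∀ m : ℕ, ∀ t ∈ D F θ k, ∀ old : OlderTerms (F.P (k + 1)) (MatA N) θ.τ9.M m,
          (∀ (j : Fin (m + 1)) (Y : (domSys (F.P (k + 1)) θ.τ9.M j).Dom), ∀ ψ ∈ (ofBackgroundC (ιSU N) '' {V : GaugeField (F.P (k + 1)) 0 (Node00.SU N) | PlaqSmall (a F θ (k + 1)) V}),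
              ‖old j Y ψ‖ ≤ E_B * Real.exp (-(κ * (domSys (F.P (k + 1)) θ.τ9.M j).dj Y))) →
          (∀ (j : Fin (m + 1)) (Y : (domSys (F.P (k + 1)) θ.τ9.M j).Dom), AnalyticOnNhd ℂ (old j Y) (ofBackgroundC (ιSU N) '' {V : GaugeField (F.P (k + 1)) 0 (Node00.SU N) | PlaqSmall (a F θ (k + 1)) V})) →
          (∀ Z : (domSys (F.P (k + 1)) θ.τ9.M (m + 1)).Dom, AnalyticOnNhd ℂ (fun φ => (G F θ (k + 1) m).H t old φ Z) (ofBackgroundC (ιSU N) '' {V : GaugeField (F.P (k + 1)) 0 (Node00.SU N) | PlaqSmall (a F θ (k + 1)) V})) ∧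
          (∀ (Z : (domSys (F.P (k + 1)) θ.τ9.M (m + 1)).Dom), ∀ φ ∈ (ofBackgroundC (ιSU N) '' {V : GaugeField (F.P (k + 1)) 0 (Node00.SU N) | PlaqSmall (a F θ (k + 1)) V}),
              ‖(G F θ (k + 1) m).H t old φ Z‖ ≤ A_B * Real.exp (-(Rd * (domSys (F.P (k + 1)) θ.τ9.M (m + 1)).dj Z)))) ∧
        0 ≤ A_B ∧ A_B * Real.exp (5 * κ + 1) * K₀ 64 8 * 9 * 64 < 1 ∧ Real.exp 1 * 9 * 64 * K₀ 64 8 ^ 2 * A_B ≤ E_B ∧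
        (∀ s ∈ Ioc (0 : ℝ) γ', ((s : ℝ) : ℂ) ∈ D F θ k) ∧
        -- the reading's letters dominate the END's
        θ.γ ≤ γ' ∧ (li F θ).κ ≤ κ ∧ θ' ≤ (li F θ).θ₅ ∧
        (Real.exp 1 * 9 * 64 * K₀ 64 8 ^ 2 * (C3 * ε₁) / (1 - ρ₀) * (δ + δ') + B) * (θ' - ω) /
            (θ' - (ω + Real.exp 1 * 9 * 64 * K₀ 64 8 ^ 2 * (C3 * ε₁) / (1 - ρ₀) * cH)) ≤ (li F θ).C₅) :
    S_N18 (RRec₁₂ (readingOfRecord₁₂ (fun F θ => ReadingData.ofRecordAdm F θ.τ9.M N (fun k => toClusterTower (G F θ k))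
      (fun (k j : ℕ) (_ : (domSys (F.P k) θ.τ9.M j).Dom) => ofBackgroundC (ιSU N) '' {V : GaugeField (F.P k) 0 (Node00.SU N) | PlaqSmall (a F θ k) V})
      (gauge F θ) (hg F θ) (fun k => transportRaw F k (avOfRecord F N (k + 1) 0)) (hT F θ) (li F θ)) ℓ₃ ne2 ne1)) := by
  refine s_N18_readingAdm₁₂_toClusterTower_of_stepGen G D _ gauge hg (fun F _ k => transportRaw F k (avOfRecord F N (k + 1) 0)) hT li ℓ₃ ne2 ne1
    fun F θ hP hA k => ?_
  obtain ⟨Op, iO₁, iO₂, Hist, iH₁, iH₂, Mb, act, γ', C3, ε₁, Rd, κ, A_A, A_B, E_A, E_B, E₁, δ, δ', θr, θ', cH, ω, ρ₀, B, k₀, hrep, hC3, hε₁, hκ, hrate,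
    hKP, hH, l01, l02, l03, l07, l08, l09aff, l09blind, l09hom, l09unit, hE₁, hδ, hθ, hθθ', hθ'1, hcH, hω, hρ₀, l10near, hB, l10first, hS, hgenA, hAA,
    hsmallA, hrenewA, hgenB, hAB, hsmallB, hrenewB, hD, hγ, hℓκ, hℓθ, hℓC⟩ := h F θ hP hA k
  exact ⟨Op, iO₁, iO₂, Hist, iH₁, iH₂, Mb, act, γ', C3, ε₁, Rd, κ, A_A, A_B, E_A, E_B, E₁, δ, δ', θr, θ', cH, ω, ρ₀, B, k₀, hrep, hC3, hε₁, hκ, hrate,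
    hKP, hH, l01, l02, l03, l07, l08, l09aff, l09blind, l09hom, l09unit, hE₁, hδ, hθ, hθθ', hθ'1, hcH, hω, hρ₀, l10near, hB, l10first, hS,
    fun _ _ _ _ => Subset.rfl, hgenA, hAA, hsmallA, hrenewA, fun _ _ _ _ => Subset.rfl, hgenB, hAB, hsmallB, hrenewB, hD, hγ, hℓκ, hℓθ, hℓC⟩

end PlaqSmall

end YMDAG.N18.W1Reading

end
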